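import Literature.MathematicalPhysics.QuantumLattice.GroundStateSpinReflectionPositivityHubbard
import Literature.MathematicalPhysics.QuantumLattice.HubbardStaggeredMomentCeiling
import HarnessLib

/-!
# The Shen–Qiu–Tian sign rule and the solver-free Néel-sum floor of the half-filled Hubbard model

Topic `MathematicalPhysics/QuantumLattice` (family `hubbard`). HONEST FRAMING (cell `pub-hubbard`,
ladder R1–R4 with certified numbers; no claim on H/H₀): this file is a finite-volume KERNEL — a
rigorous sign rule for THE half-filled ground state and the lower bound on the staggered spin
structure it implies; it says nothing about long-range order.

Setting: the Hubbard Hamiltonian `hamiltonian G t U` (`HubbardWave0`) on a finite connected bipartite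
graph `G` on an ordered site set `Λ` with colour class `A` (`x ∼ y → (x ∈ A ↔ y ∉ A)`), `|Aᶜ| = |A|`,
`t ≠ 0`, `U > 0`, in the half-filled sector `N = |Λ|`; by Lieb's Theorem 2 the ground state `ψ` is
unique and a singlet (`LiebHalfFilled.finrank_groundSector_eq_one`) and, in Lieb's two-species
coordinates, `ψ = c • Φ_A(W₀)` with `W₀ ≻ 0`; the landed Gram block
`LiebTwo.liebForm_expect_nonneg` (`GroundStateSpinReflectionPositivityHubbard`) packages the
resulting "spin-reflection positivity" `⟨ψ, u(a) d̃(b) ψ⟩`-Gram matrices.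

* **The elementary word** (`upWord_pair_mul_shibaDownWord_pair`): for one site pair,
  `u[(x,y)] d̃_ε[(x,y)] = ε_x ε_y · S⁺_x S⁻_y` (`c†_{x↑} c_{y↑} · c_{x↓} c†_{y↓} = S⁺_x S⁻_y` by the CAR).
* **The Shen–Qiu–Tian sign rule** (`shenQiuTian_sign_rule`): for THE half-filled ground state and
  all sites `x, y`, `ε_x ε_y ⟨ψ, S⁺_x S⁻_y ψ⟩ ≥ 0` (`ε = stagSign A = ±1` the sublattice sign): the
  transverse spin correlation is non-negative on equal sublattices and non-positive on opposite ones.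
  (Shen–Qiu–Tian 1994 prove it for `|A| ≠ |B|` as well; here the balanced case, as a corollary of the
  `1 × 1` Gram block.)
* **SU(2) isotropy on singlets** (`expect_fermionSpinDot_eq_of_singlet`): from the commutators
  `[S⁺_x, S⁻] = 2 S^z_x`, `[S^z_y, S⁻] = -S⁻_y` (and adjoints): if `S⁺ ψ = S⁻ ψ = 0` then
  `⟨ψ, S⁺_x S⁻_y ψ⟩ = ⟨ψ, S⁻_x S⁺_y ψ⟩ = 2 ⟨ψ, S^z_x S^z_y ψ⟩`, hence
  `⟨ψ, 𝐒_x·𝐒_y ψ⟩ = (3/2) ⟨ψ, S⁺_x S⁻_y ψ⟩` for all `x, y`.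
* **The Néel-sum floor** (`three_halves_localMoment_le_stagSpinStructure`): for THE half-filled
  ground state, `(3/2) Re ⟨ψ, (Σ_x m_x) ψ⟩ ≤ Re ⟨ψ, 𝓢_A ψ⟩`, where
  `𝓢_A = Σ_{x,y} ε_x ε_y 𝐒_x·𝐒_y` is the staggered spin structure operator
  (`FermionSpinMoment.stagSpinStructure`) and `m_x = (n_{x↑} - n_{x↓})²` the local moment: by
  `𝓢_A = 2 𝐒_A² + 2 𝐒_{Aᶜ}² - S²` (`stagSpinStructure_eq`) and `S² ψ = 0`, only same-sublattice pairs
  remain, each `≥ 0` by the sign rule and isotropy, and the diagonal is `𝐒_x·𝐒_x = ¾ m_x`.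
  Together with the moment-depletion CEILING `𝓢_A ≤ ((k+2)/2) Σ_x m_x`
  (`re_expect_stagSpinStructure_le`) the finite-volume staggered magnetisation
  `m_s² = ⟨𝓢_A⟩/|Λ|²` is bracketed two-sidedly by the local moment `⟨Σ m_x⟩ = N - 2⟨D̂⟩` alone.
* **AF sign structure and Néel-sum domination** (`re_expect_fermionSpinDot_nonpos_of_opposite_sublattice`,
  `norm_expect_fermionSpinDot_le`, `norm_expect_modulated_spinDot_le_stagSpinStructure`): in THE half-filled
  ground state `⟨ψ, 𝐒_x·𝐒_y ψ⟩ ≤ 0` across the sublattices and `≥ 0` within, `|⟨ψ, 𝐒_x·𝐒_y ψ⟩| =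
  ε_x ε_y ⟨ψ, 𝐒_x·𝐒_y ψ⟩`, hence for all weights `|a_x|, |b_y| ≤ 1`,
  `|⟨ψ, (Σ_{x,y} a_x b_y 𝐒_x·𝐒_y) ψ⟩| ≤ ⟨ψ, 𝓢_A ψ⟩` — every modulated spin structure (in particular the
  spin structure factor `S(q)` at every momentum `q`, `a_x = e^{iq·x}`, `b_y = e^{-iq·y}`) is dominated by
  the staggered one: `S(q) ≤ S(Q)`, `Q = (π, π)`.
* The even square torus `(ℤ/Lℤ)²`, `A = {ε_x = +1}`: `hubbardTorus_shenQiuTian_sign_rule`,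
  `hubbardTorus_three_halves_localMoment_le_stagSpinStructure`,
  `hubbardTorus_norm_expect_modulated_spinDot_le_stagSpinStructure`.

Everything is a proved theorem; no named fact, no `sorry`.

## References
* S.-Q. Shen, Z.-M. Qiu, G.-S. Tian, *Ferrimagnetic long-range order of the Hubbard model*,
  Phys. Rev. Lett. 72 (1994) 1280 (spin-reflection positivity ⇒ the sign rule for the transverse
  spin correlation of the half-filled ground state). [cite: ShenQiuTian1994, Theorem and eqs. (7)–(9)]
* G.-S. Tian, *Lieb's spin-reflection-positivity method and its applications to strongly correlated
  electron systems*, J. Stat. Phys. 116 (2004) 629, §3 (the correlation-function sign rules).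
  [cite: Tian2004, §3]
* E. H. Lieb, *Two theorems on the Hubbard model*, Phys. Rev. Lett. 62 (1989) 1201, Theorem 2 and its
  proof. [cite: LiebPRL1989, Theorem 2]
* F. H. L. Essler et al., *The One-Dimensional Hubbard Model*, CUP (2005), §2.2.5 (local spin
  operators and their `su(2)` relations). [cite: EsslerEtAl2005, §2.2.5 eqs. (2.71)–(2.73)]
-/

noncomputable section

namespace Literature.MathematicalPhysics.QuantumLattice

open Matrix Finset LiebTwo FermionSpinMoment
open scoped ComplexOrder

section Generic

variable {Λ : Type*} [LinearOrder Λ] [Fintype Λ]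

/-! ### §1 The elementary word: `u[(x,y)] d̃[(x,y)] = ε_x ε_y S⁺_x S⁻_y` -/

/-- `c†_{x↑} c_{y↑} · c_{x↓} c†_{y↓} = (c†_{x↑} c_{x↓}) (c†_{y↓} c_{y↑}) = S⁺_x S⁻_y` (CAR; the two
transpositions of `c_{y↑}` past down operators cost no sign on balance).
[cite: EsslerEtAl2005, §2.2.5 eqs. (2.71)–(2.73)] -/
theorem upHop_mul_downHole_eq_spinPlus_mul_spinMinus (x y : Λ) :
    creation (orb x 0) * annihilation (orb y 0) * (annihilation (orb x 1) * creation (orb y 1)) =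
      fermionSpinPlus x * fermionSpinMinus y := by
  have h01 : orb y 0 ≠ orb y 1 := by rw [Ne, orb_inj]; simp
  rw [fermionSpinPlus, fermionSpinMinus]
  calc creation (orb x 0) * annihilation (orb y 0) * (annihilation (orb x 1) * creation (orb y 1))
      = creation (orb x 0) * (annihilation (orb y 0) * annihilation (orb x 1)) * creation (orb y 1) := by
        simp only [Matrix.mul_assoc]
    _ = -(creation (orb x 0) * annihilation (orb x 1) *
          (annihilation (orb y 0) * creation (orb y 1))) := by
        rw [LiebThm1.annihilation_mul_annihilation_eq_neg (orb y 0) (orb x 1)]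
        simp only [Matrix.mul_neg, Matrix.neg_mul, Matrix.mul_assoc]
    _ = creation (orb x 0) * annihilation (orb x 1) * (creation (orb y 1) * annihilation (orb y 0)) := by
        rw [annihilation_mul_creation, if_neg h01, zero_sub, Matrix.mul_neg, neg_neg]

/-- **The elementary Lieb word is the staggered transverse spin flip**:
`u[(x,y)] d̃_ε[(x,y)] = ε_x ε_y · S⁺_x S⁻_y`. [cite: LiebPRL1989, Theorem 2] -/
theorem upWord_pair_mul_shibaDownWord_pair (ε : Λ → ℂ) (x y : Λ) :
    upWord [(x, y)] * shibaDownWord ε [(x, y)] =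
      (ε x * ε y) • (fermionSpinPlus x * fermionSpinMinus y) := by
  have hu : upWord [(x, y)] = creation (orb x 0) * annihilation (orb y 0) := by
    simp [upWord]
  have hd : shibaDownWord ε [(x, y)] = (ε x * ε y) • (annihilation (orb x 1) * creation (orb y 1)) := by
    simp [shibaDownWord]
  rw [hu, hd, Matrix.mul_smul, upHop_mul_downHole_eq_spinPlus_mul_spinMinus]

omit [Fintype Λ] in
/-- The kernel's `stagSign A = ±1` is an admissible Shiba sign: `ε_x ε_y = memSign A x · memSign A y`
(`stagSign A = -memSign A`). [cite: LiebPRL1989, Theorem 2] -/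
theorem stagSign_mul_stagSign_eq_memSign (A : Finset Λ) (x y : Λ) :
    stagSign A x * stagSign A y = memSign A x * memSign A y := by
  unfold stagSign memSign
  split_ifs <;> norm_num

omit [Fintype Λ] in
/-- `ε_x ε_x = 1`. [cite: LiebPRL1989, Theorem 2] -/
theorem stagSign_mul_self (A : Finset Λ) (x : Λ) : stagSign A x * stagSign A x = 1 := by
  unfold stagSign; split_ifs <;> norm_num

omit [Fintype Λ] in
/-- `ε_x ε_y = 1` on the same sublattice `A`. [cite: LiebPRL1989, Theorem 2] -/
theorem stagSign_mul_of_mem {A : Finset Λ} {x y : Λ} (hx : x ∈ A) (hy : y ∈ A) :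
    stagSign A x * stagSign A y = 1 := by
  rw [stagSign_of_mem hx, stagSign_of_mem hy, one_mul]

/-- `ε_x ε_y = 1` on the same sublattice `Aᶜ`. [cite: LiebPRL1989, Theorem 2] -/
theorem stagSign_mul_of_mem_compl {A : Finset Λ} {x y : Λ} (hx : x ∈ Aᶜ) (hy : y ∈ Aᶜ) :
    stagSign A x * stagSign A y = 1 := by
  rw [stagSign_of_mem_compl hx, stagSign_of_mem_compl hy]; norm_num

/-! ### §2 The Shen–Qiu–Tian sign rule (balanced bipartite case) -/

variable {G : SimpleGraph Λ} [DecidableRel G.Adj]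

/-- **The Shen–Qiu–Tian sign rule.** On a connected bipartite graph with colour class `A`,
`|Aᶜ| = |A|`, `t ≠ 0`, `U > 0`: for every half-filled ground state `ψ` (`N = |Λ|`, `H ψ = E₀ ψ`) and
all sites `x, y`, `ε_x ε_y ⟨ψ, S⁺_x S⁻_y ψ⟩ ≥ 0` (a non-negative real), `ε = stagSign A`. The `1 × 1`
case of Lieb's Gram block `liebForm_expect_nonneg` with the word `[(x, y)]`.
[cite: ShenQiuTian1994, Theorem and eqs. (7)–(9)] [cite: Tian2004, §3] -/
theorem shenQiuTian_sign_rule (hG : G.Connected) (A : Finset Λ)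
    (hA : ∀ x y : Λ, G.Adj x y → (x ∈ A ↔ y ∉ A)) (hcard : Aᶜ.card = A.card)
    {t U : ℝ} (ht : t ≠ 0) (hU : 0 < U) {ψ : Fock (Orb Λ)} (hN : IsNParticle (Fintype.card Λ) ψ)
    (hHψ : hamiltonian G t U *ᵥ ψ = ((groundEnergyAt G t U (Fintype.card Λ) : ℝ) : ℂ) • ψ)
    (x y : Λ) :
    0 ≤ stagSign A x * stagSign A y * (star ψ ⬝ᵥ ((fermionSpinPlus x * fermionSpinMinus y) *ᵥ ψ)) := by
  classical
  have h := liebForm_expect_nonneg hG A hA hcard ht hU (stagSign_mul_stagSign_eq_memSign A) hN hHψ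
    (Gm := (1 : Matrix Unit Unit ℂ)) Matrix.PosSemidef.one (fun _ => [(x, y)])
  have hform : liebForm (stagSign A) (1 : Matrix Unit Unit ℂ) (fun _ => [(x, y)]) =
      (stagSign A x * stagSign A y) • (fermionSpinPlus x * fermionSpinMinus y) := by
    simp [liebForm, upWord_pair_mul_shibaDownWord_pair]
  rwa [hform, Matrix.smul_mulVec, dotProduct_smul, smul_eq_mul] at h

/-- Real-part form of the sign rule: `0 ≤ ε_x ε_y Re ⟨ψ, S⁺_x S⁻_y ψ⟩`.
[cite: ShenQiuTian1994, Theorem and eqs. (7)–(9)] -/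
theorem shenQiuTian_sign_rule_re (hG : G.Connected) (A : Finset Λ)
    (hA : ∀ x y : Λ, G.Adj x y → (x ∈ A ↔ y ∉ A)) (hcard : Aᶜ.card = A.card)
    {t U : ℝ} (ht : t ≠ 0) (hU : 0 < U) {ψ : Fock (Orb Λ)} (hN : IsNParticle (Fintype.card Λ) ψ)
    (hHψ : hamiltonian G t U *ᵥ ψ = ((groundEnergyAt G t U (Fintype.card Λ) : ℝ) : ℂ) • ψ)
    (x y : Λ) :
    0 ≤ (stagSign A x * stagSign A y * (star ψ ⬝ᵥ ((fermionSpinPlus x * fermionSpinMinus y) *ᵥ ψ))).re :=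
  (Complex.nonneg_iff.mp (shenQiuTian_sign_rule hG A hA hcard ht hU hN hHψ x y)).1

/-! ### §3 `su(2)` commutators of the local spin operators and isotropy on singlets -/

omit [DecidableRel G.Adj] in
/-- `[S⁺_x, S⁻] = 2 S^z_x` (`S⁻ = Σ_w S⁻_w`; `[c†_{x↑}c_{x↓}, c†_{w↓}c_{w↑}] = δ_{xw}(n_{x↑} - n_{x↓})`).
[cite: EsslerEtAl2005, §2.2.5 eqs. (2.71)–(2.73)] -/
theorem fermionSpinPlus_mul_spinMinus_sub (x : Λ) :
    fermionSpinPlus x * spinMinus - spinMinus * fermionSpinPlus x = (2 : ℂ) • fermionSpinZ x := by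
  rw [← sum_fermionSpinMinus, Finset.mul_sum, Finset.sum_mul, ← Finset.sum_sub_distrib]
  simp only [fermionSpinPlus, fermionSpinMinus, LiebThm1.creation_mul_annihilation_commutator, orb_inj,
    and_true, Finset.sum_sub_distrib, Finset.sum_ite_eq, Finset.mem_univ, if_true]
  rw [fermionSpinZ, smul_smul, numberOp, numberOp]
  norm_num

omit [DecidableRel G.Adj] in
/-- `[n_{yσ}, S⁻]`: `[n_{y↑}, S⁻] = -S⁻_y`, `[n_{y↓}, S⁻] = S⁻_y`. [cite: EsslerEtAl2005, §2.2.5 eqs. (2.71)–(2.73)] -/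
theorem numberOp_mul_spinMinus_sub (y : Λ) (σ : Fin 2) :
    numberOp y σ * spinMinus - spinMinus * numberOp y σ =
      if σ = 0 then -fermionSpinMinus y else fermionSpinMinus y := by
  rw [← sum_fermionSpinMinus, Finset.mul_sum, Finset.sum_mul, ← Finset.sum_sub_distrib]
  simp only [numberOp, fermionSpinMinus, LiebThm1.creation_mul_annihilation_commutator, orb_inj]
  fin_cases σ
  · simp [Finset.sum_ite_eq]
  · simp [Finset.sum_ite_eq]

omit [DecidableRel G.Adj] in
/-- `[S^z_y, S⁻] = -S⁻_y`. [cite: EsslerEtAl2005, §2.2.5 eqs. (2.71)–(2.73)] -/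
theorem fermionSpinZ_mul_spinMinus_sub (y : Λ) :
    fermionSpinZ y * spinMinus - spinMinus * fermionSpinZ y = -fermionSpinMinus y := by
  have h0 := numberOp_mul_spinMinus_sub y 0
  have h1 := numberOp_mul_spinMinus_sub y 1
  rw [if_pos rfl] at h0
  rw [if_neg (by decide)] at h1
  rw [fermionSpinZ, smul_mul_assoc, mul_smul_comm, ← smul_sub, sub_mul, mul_sub,
    show numberOp y 0 * spinMinus - numberOp y 1 * spinMinus -
        (spinMinus * numberOp y 0 - spinMinus * numberOp y 1) =
      (numberOp y 0 * spinMinus - spinMinus * numberOp y 0) -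
        (numberOp y 1 * spinMinus - spinMinus * numberOp y 1) by abel, h0, h1,
    show -fermionSpinMinus y - fermionSpinMinus y = -((2 : ℂ) • fermionSpinMinus y) by
      rw [two_smul]; abel, smul_neg, smul_smul]
  norm_num

omit [DecidableRel G.Adj] in
/-- `[S^z_y, S⁺] = S⁺_y` (adjoint of `[S^z_y, S⁻] = -S⁻_y`). [cite: EsslerEtAl2005, §2.2.5 eqs. (2.71)–(2.73)] -/
theorem fermionSpinZ_mul_spinPlus_sub (y : Λ) :
    fermionSpinZ y * spinPlus - spinPlus * fermionSpinZ y = fermionSpinPlus y := by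
  have h := congrArg conjTranspose (fermionSpinZ_mul_spinMinus_sub y)
  rw [conjTranspose_sub, conjTranspose_mul, conjTranspose_mul, conjTranspose_neg,
    conjTranspose_fermionSpinMinus, conjTranspose_fermionSpinZ, spinMinus,
    conjTranspose_conjTranspose] at h
  rw [← neg_sub, h, neg_neg]

omit [DecidableRel G.Adj] in
/-- `[S⁻_x, S⁺] = -2 S^z_x` (adjoint of `[S⁺_x, S⁻] = 2 S^z_x`). [cite: EsslerEtAl2005, §2.2.5 eqs. (2.71)–(2.73)] -/
theorem fermionSpinMinus_mul_spinPlus_sub (x : Λ) :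
    fermionSpinMinus x * spinPlus - spinPlus * fermionSpinMinus x = -((2 : ℂ) • fermionSpinZ x) := by
  have h := congrArg conjTranspose (fermionSpinPlus_mul_spinMinus_sub x)
  rw [conjTranspose_sub, conjTranspose_mul, conjTranspose_mul, conjTranspose_smul,
    conjTranspose_fermionSpinPlus, conjTranspose_fermionSpinZ, spinMinus,
    conjTranspose_conjTranspose, show star (2 : ℂ) = 2 by norm_num] at h
  rw [← neg_sub, h]

omit [DecidableRel G.Adj] in
/-- **Isotropy, `+-` component**: if `S⁺ ψ = 0` and `S⁻ ψ = 0` then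
`⟨ψ, S⁺_x S⁻_y ψ⟩ = 2 ⟨ψ, S^z_x S^z_y ψ⟩` (`S⁻_y ψ = S⁻ S^z_y ψ`, `S⁺_x S⁻ = S⁻ S⁺_x + 2 S^z_x`,
`⟨ψ, S⁻ ·⟩ = ⟨S⁺ ψ, ·⟩ = 0`). [cite: EsslerEtAl2005, §2.2.5 eqs. (2.71)–(2.73)] -/
theorem expect_spinPlus_mul_spinMinus_eq_of_singlet {ψ : Fock (Orb Λ)} (hP : spinPlus *ᵥ ψ = 0)
    (hM : spinMinus *ᵥ ψ = 0) (x y : Λ) :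
    star ψ ⬝ᵥ ((fermionSpinPlus x * fermionSpinMinus y) *ᵥ ψ) =
      2 * (star ψ ⬝ᵥ ((fermionSpinZ x * fermionSpinZ y) *ᵥ ψ)) := by
  have hψM : star ψ ᵥ* spinMinus = 0 := by rw [spinMinus, ← star_mulVec, hP, star_zero]
  have hB : fermionSpinMinus y = spinMinus * fermionSpinZ y - fermionSpinZ y * spinMinus := by
    rw [← neg_sub, fermionSpinZ_mul_spinMinus_sub, neg_neg]
  have hA : fermionSpinPlus x * spinMinus = spinMinus * fermionSpinPlus x + (2 : ℂ) • fermionSpinZ x := by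
    rw [← fermionSpinPlus_mul_spinMinus_sub]; abel
  have hO : fermionSpinPlus x * fermionSpinMinus y =
      spinMinus * (fermionSpinPlus x * fermionSpinZ y) + (2 : ℂ) • (fermionSpinZ x * fermionSpinZ y) -
        fermionSpinPlus x * fermionSpinZ y * spinMinus := by
    rw [hB, mul_sub, ← Matrix.mul_assoc, ← Matrix.mul_assoc, hA, add_mul, smul_mul_assoc,
      Matrix.mul_assoc spinMinus]
  rw [hO, sub_mulVec, add_mulVec, Matrix.smul_mulVec,
    ← mulVec_mulVec ψ spinMinus (fermionSpinPlus x * fermionSpinZ y),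
    ← mulVec_mulVec ψ (fermionSpinPlus x * fermionSpinZ y) spinMinus, hM, mulVec_zero, sub_zero,
    dotProduct_add, dotProduct_mulVec, hψM, zero_dotProduct, zero_add, dotProduct_smul, smul_eq_mul]

omit [DecidableRel G.Adj] in
/-- **Isotropy, `-+` component**: if `S⁺ ψ = 0` and `S⁻ ψ = 0` then
`⟨ψ, S⁻_x S⁺_y ψ⟩ = 2 ⟨ψ, S^z_x S^z_y ψ⟩`. [cite: EsslerEtAl2005, §2.2.5 eqs. (2.71)–(2.73)] -/
theorem expect_spinMinus_mul_spinPlus_eq_of_singlet {ψ : Fock (Orb Λ)} (hP : spinPlus *ᵥ ψ = 0)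
    (hM : spinMinus *ᵥ ψ = 0) (x y : Λ) :
    star ψ ⬝ᵥ ((fermionSpinMinus x * fermionSpinPlus y) *ᵥ ψ) =
      2 * (star ψ ⬝ᵥ ((fermionSpinZ x * fermionSpinZ y) *ᵥ ψ)) := by
  have hψP : star ψ ᵥ* spinPlus = 0 := by
    rw [← conjTranspose_conjTranspose spinPlus, ← star_mulVec]
    change star (spinMinus *ᵥ ψ) = 0
    rw [hM, star_zero]
  have hB : fermionSpinPlus y = fermionSpinZ y * spinPlus - spinPlus * fermionSpinZ y :=
    (fermionSpinZ_mul_spinPlus_sub y).symm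
  have hA : fermionSpinMinus x * spinPlus = spinPlus * fermionSpinMinus x - (2 : ℂ) • fermionSpinZ x := by
    rw [sub_eq_add_neg, ← fermionSpinMinus_mul_spinPlus_sub]; abel
  have hO : fermionSpinMinus x * fermionSpinPlus y =
      fermionSpinMinus x * fermionSpinZ y * spinPlus - spinPlus * (fermionSpinMinus x * fermionSpinZ y) +
        (2 : ℂ) • (fermionSpinZ x * fermionSpinZ y) := by
    rw [hB, mul_sub, ← Matrix.mul_assoc, ← Matrix.mul_assoc, hA, sub_mul, smul_mul_assoc,
      Matrix.mul_assoc spinPlus]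
    abel
  rw [hO, add_mulVec, sub_mulVec, Matrix.smul_mulVec,
    ← mulVec_mulVec ψ (fermionSpinMinus x * fermionSpinZ y) spinPlus, hP, mulVec_zero, zero_sub,
    ← mulVec_mulVec ψ spinPlus (fermionSpinMinus x * fermionSpinZ y), dotProduct_add, dotProduct_neg,
    dotProduct_mulVec, hψP, zero_dotProduct, neg_zero, zero_add, dotProduct_smul, smul_eq_mul]

omit [DecidableRel G.Adj] in
/-- **SU(2) isotropy of the spin correlation on singlets**: if `S⁺ ψ = S⁻ ψ = 0` then for all `x, y`
`⟨ψ, 𝐒_x·𝐒_y ψ⟩ = (3/2) ⟨ψ, S⁺_x S⁻_y ψ⟩` (`= 3 ⟨ψ, S^z_x S^z_y ψ⟩`).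
[cite: EsslerEtAl2005, §2.2.5 eqs. (2.71)–(2.73)] -/
theorem expect_fermionSpinDot_eq_of_singlet {ψ : Fock (Orb Λ)} (hP : spinPlus *ᵥ ψ = 0)
    (hM : spinMinus *ᵥ ψ = 0) (x y : Λ) :
    star ψ ⬝ᵥ (fermionSpinDot x y *ᵥ ψ) =
      (3 / 2 : ℂ) * (star ψ ⬝ᵥ ((fermionSpinPlus x * fermionSpinMinus y) *ᵥ ψ)) := by
  rw [fermionSpinDot_def, add_mulVec, Matrix.smul_mulVec, add_mulVec, dotProduct_add,
    dotProduct_smul, dotProduct_add, expect_spinPlus_mul_spinMinus_eq_of_singlet hP hM,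
    expect_spinMinus_mul_spinPlus_eq_of_singlet hP hM, smul_eq_mul]
  ring

omit [DecidableRel G.Adj] in
/-- **A singlet vector is killed by every spin component**: `S² ψ = 0 ⇒ S⁺ ψ = S⁻ ψ = S^z ψ = 0`
(`0 = ⟨ψ, S² ψ⟩ = ‖S^z ψ‖² + ½‖S⁻ ψ‖² + ½‖S⁺ ψ‖²`). [cite: Tasaki2020, App. A.3] -/
theorem spin_mulVec_eq_zero_of_spinSq_mulVec_eq_zero {ψ : Fock (Orb Λ)} (h : spinSq *ᵥ ψ = 0) :
    spinPlus *ᵥ ψ = 0 ∧ spinMinus *ᵥ ψ = 0 ∧ HubbardWave0.spinZ *ᵥ ψ = 0 := by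
  have hSz := (HubbardWave0.spinZ_isHermitian (Λ := Λ)).eq
  have ha : star ψ ⬝ᵥ ((HubbardWave0.spinZ * HubbardWave0.spinZ) *ᵥ ψ) =
      star (HubbardWave0.spinZ *ᵥ ψ) ⬝ᵥ (HubbardWave0.spinZ *ᵥ ψ) := by
    rw [star_mulVec, hSz, ← dotProduct_mulVec, mulVec_mulVec]
  have hb : star ψ ⬝ᵥ ((spinPlus * spinPlusᴴ) *ᵥ ψ) =
      star (spinPlusᴴ *ᵥ ψ) ⬝ᵥ (spinPlusᴴ *ᵥ ψ) := by
    rw [star_mulVec, conjTranspose_conjTranspose, ← dotProduct_mulVec, mulVec_mulVec]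
  have hc : star ψ ⬝ᵥ ((spinPlusᴴ * spinPlus) *ᵥ ψ) =
      star (spinPlus *ᵥ ψ) ⬝ᵥ (spinPlus *ᵥ ψ) := by
    rw [star_mulVec, ← dotProduct_mulVec, mulVec_mulVec]
  have hsum : star ψ ⬝ᵥ (spinSq *ᵥ ψ) =
      star (HubbardWave0.spinZ *ᵥ ψ) ⬝ᵥ (HubbardWave0.spinZ *ᵥ ψ) +
        (1 / 2 : ℂ) * (star (spinPlusᴴ *ᵥ ψ) ⬝ᵥ (spinPlusᴴ *ᵥ ψ) +
          star (spinPlus *ᵥ ψ) ⬝ᵥ (spinPlus *ᵥ ψ)) := by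
    rw [spinSq, add_mulVec, Matrix.smul_mulVec, add_mulVec, dotProduct_add, dotProduct_smul,
      dotProduct_add, ha, hb, hc, smul_eq_mul]
  rw [h, dotProduct_zero] at hsum
  have h1 : 0 ≤ star (HubbardWave0.spinZ *ᵥ ψ) ⬝ᵥ (HubbardWave0.spinZ *ᵥ ψ) :=
    dotProduct_star_self_nonneg _
  have h2 : 0 ≤ star (spinPlusᴴ *ᵥ ψ) ⬝ᵥ (spinPlusᴴ *ᵥ ψ) := dotProduct_star_self_nonneg _
  have h3 : 0 ≤ star (spinPlus *ᵥ ψ) ⬝ᵥ (spinPlus *ᵥ ψ) := dotProduct_star_self_nonneg _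
  have hhalf : (0 : ℂ) ≤ 1 / 2 := by
    rw [show (1 / 2 : ℂ) = ((1 / 2 : ℝ) : ℂ) by push_cast; ring]
    exact Complex.zero_le_real.2 (by norm_num)
  have h23 : 0 ≤ (1 / 2 : ℂ) * (star (spinPlusᴴ *ᵥ ψ) ⬝ᵥ (spinPlusᴴ *ᵥ ψ) +
      star (spinPlus *ᵥ ψ) ⬝ᵥ (spinPlus *ᵥ ψ)) := mul_nonneg hhalf (add_nonneg h2 h3)
  obtain ⟨hz1, hz23⟩ := (add_eq_zero_iff_of_nonneg h1 h23).1 hsum.symm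
  have hz23' : star (spinPlusᴴ *ᵥ ψ) ⬝ᵥ (spinPlusᴴ *ᵥ ψ) +
      star (spinPlus *ᵥ ψ) ⬝ᵥ (spinPlus *ᵥ ψ) = 0 := by
    rcases mul_eq_zero.1 hz23 with h0 | h0
    · norm_num at h0
    · exact h0
  obtain ⟨hz2, hz3⟩ := (add_eq_zero_iff_of_nonneg h2 h3).1 hz23'
  exact ⟨dotProduct_star_self_eq_zero.1 hz3, dotProduct_star_self_eq_zero.1 hz2,
    dotProduct_star_self_eq_zero.1 hz1⟩

/-! ### §4 The Néel-sum floor -/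

/-- **Same-sublattice spin correlations of THE half-filled ground state are non-negative**:
for `x, y` both in `A` or both in `Aᶜ`, `Re ⟨ψ, 𝐒_x·𝐒_y ψ⟩ ≥ 0` (isotropy ∘ sign rule).
[cite: ShenQiuTian1994, Theorem and eqs. (7)–(9)] [cite: Tian2004, §3] -/
theorem re_expect_fermionSpinDot_nonneg_of_same_sublattice (hG : G.Connected) (A : Finset Λ)
    (hA : ∀ x y : Λ, G.Adj x y → (x ∈ A ↔ y ∉ A)) (hcard : Aᶜ.card = A.card)
    {t U : ℝ} (ht : t ≠ 0) (hU : 0 < U) {ψ : Fock (Orb Λ)} (hN : IsNParticle (Fintype.card Λ) ψ)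
    (hHψ : hamiltonian G t U *ᵥ ψ = ((groundEnergyAt G t U (Fintype.card Λ) : ℝ) : ℂ) • ψ)
    {x y : Λ} (hxy : stagSign A x * stagSign A y = 1) :
    0 ≤ (star ψ ⬝ᵥ (fermionSpinDot x y *ᵥ ψ)).re := by
  have hmem : ψ ∈ (hamiltonian G t U).sectorGroundSpace
      (nParticleSubmodule (ι := Orb Λ) (Fintype.card Λ)) :=
    (LiebHalfFilled.mem_groundSector_iff G t U _ ψ).2 ⟨hN, hHψ⟩
  have hS := (LiebHalfFilled.finrank_groundSector_eq_one hG A hA hcard ht hU).2 ψ hmem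
  obtain ⟨hP, hM, -⟩ := spin_mulVec_eq_zero_of_spinSq_mulVec_eq_zero hS
  have hsign := shenQiuTian_sign_rule_re hG A hA hcard ht hU hN hHψ x y
  rw [hxy, one_mul] at hsign
  rw [expect_fermionSpinDot_eq_of_singlet hP hM, show (3 / 2 : ℂ) = ((3 / 2 : ℝ) : ℂ) by push_cast; ring,
    Complex.re_ofReal_mul]
  exact mul_nonneg (by norm_num) hsign

omit [DecidableRel G.Adj] in
/-- Bookkeeping: `Re ⟨ψ, (Σ_{x∈Y} Σ_{y∈Y} 𝐒_x·𝐒_y) ψ⟩ ≥ (3/4) Σ_{x∈Y} Re ⟨ψ, m_x ψ⟩` whenever all the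
summands have non-negative real part (drop the off-diagonal ones; `𝐒_x·𝐒_x = ¾ m_x`).
[cite: Tasaki2020, App. A.3] -/
theorem re_expect_sum_sum_fermionSpinDot_ge (Y : Finset Λ) {ψ : Fock (Orb Λ)}
    (h : ∀ x ∈ Y, ∀ y ∈ Y, 0 ≤ (star ψ ⬝ᵥ (fermionSpinDot x y *ᵥ ψ)).re) :
    (3 / 4 : ℝ) * ∑ x ∈ Y, (star ψ ⬝ᵥ (localMoment x *ᵥ ψ)).re ≤
      (star ψ ⬝ᵥ ((∑ x ∈ Y, ∑ y ∈ Y, fermionSpinDot x y) *ᵥ ψ)).re := by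
  rw [Matrix.sum_mulVec, dotProduct_sum, Complex.re_sum, Finset.mul_sum]
  refine Finset.sum_le_sum fun x hx => ?_
  rw [Matrix.sum_mulVec, dotProduct_sum, Complex.re_sum]
  have hdiag : (3 / 4 : ℝ) * (star ψ ⬝ᵥ (localMoment x *ᵥ ψ)).re =
      (star ψ ⬝ᵥ (fermionSpinDot x x *ᵥ ψ)).re := by
    rw [fermionSpinDot_self, Matrix.smul_mulVec, dotProduct_smul, smul_eq_mul,
      show (3 / 4 : ℂ) = ((3 / 4 : ℝ) : ℂ) by push_cast; ring, Complex.re_ofReal_mul]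
  rw [hdiag]
  exact Finset.single_le_sum (f := fun y => (star ψ ⬝ᵥ (fermionSpinDot x y *ᵥ ψ)).re)
    (fun y hy => h x hx y hy) hx

/-- **The Néel-sum floor of the half-filled Hubbard ground state.** On a connected bipartite graph
with colour class `A`, `|Aᶜ| = |A|`, `t ≠ 0`, `U > 0`: for every half-filled ground state `ψ`,
`(3/2) Re ⟨ψ, (Σ_x m_x) ψ⟩ ≤ Re ⟨ψ, 𝓢_A ψ⟩` — the staggered spin structure is bounded BELOW by the
local moment, with no solver: `𝓢_A = 2𝐒_A² + 2𝐒_{Aᶜ}² - S²`, `S² ψ = 0`, same-sublattice pairs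
`≥ 0` (sign rule + isotropy), diagonal `¾ Σ m_x`. [cite: ShenQiuTian1994, Theorem and eqs. (7)–(9)]
[cite: LiebPRL1989, Theorem 2] -/
theorem three_halves_localMoment_le_stagSpinStructure (hG : G.Connected) (A : Finset Λ)
    (hA : ∀ x y : Λ, G.Adj x y → (x ∈ A ↔ y ∉ A)) (hcard : Aᶜ.card = A.card)
    {t U : ℝ} (ht : t ≠ 0) (hU : 0 < U) {ψ : Fock (Orb Λ)} (hN : IsNParticle (Fintype.card Λ) ψ)
    (hHψ : hamiltonian G t U *ᵥ ψ = ((groundEnergyAt G t U (Fintype.card Λ) : ℝ) : ℂ) • ψ) :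
    (3 / 2 : ℝ) * (star ψ ⬝ᵥ ((∑ x, localMoment x) *ᵥ ψ)).re ≤
      (star ψ ⬝ᵥ (stagSpinStructure A *ᵥ ψ)).re := by
  classical
  have hmem : ψ ∈ (hamiltonian G t U).sectorGroundSpace
      (nParticleSubmodule (ι := Orb Λ) (Fintype.card Λ)) :=
    (LiebHalfFilled.mem_groundSector_iff G t U _ ψ).2 ⟨hN, hHψ⟩
  have hS := (LiebHalfFilled.finrank_groundSector_eq_one hG A hA hcard ht hU).2 ψ hmem
  have hAA : ∀ x ∈ A, ∀ y ∈ A, 0 ≤ (star ψ ⬝ᵥ (fermionSpinDot x y *ᵥ ψ)).re := fun x hx y hy =>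
    re_expect_fermionSpinDot_nonneg_of_same_sublattice hG A hA hcard ht hU hN hHψ (stagSign_mul_of_mem hx hy)
  have hBB : ∀ x ∈ Aᶜ, ∀ y ∈ Aᶜ, 0 ≤ (star ψ ⬝ᵥ (fermionSpinDot x y *ᵥ ψ)).re := fun x hx y hy =>
    re_expect_fermionSpinDot_nonneg_of_same_sublattice hG A hA hcard ht hU hN hHψ
      (stagSign_mul_of_mem_compl hx hy)
  have h1 := re_expect_sum_sum_fermionSpinDot_ge A hAA
  have h2 := re_expect_sum_sum_fermionSpinDot_ge Aᶜ hBB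
  have htot : star ψ ⬝ᵥ ((∑ x, ∑ y, fermionSpinDot x y) *ᵥ ψ) = 0 := by
    rw [sum_sum_fermionSpinDot, hS, dotProduct_zero]
  have hM : (star ψ ⬝ᵥ ((∑ x, localMoment x) *ᵥ ψ)).re =
      ∑ x ∈ A, (star ψ ⬝ᵥ (localMoment x *ᵥ ψ)).re + ∑ x ∈ Aᶜ, (star ψ ⬝ᵥ (localMoment x *ᵥ ψ)).re := by
    rw [Matrix.sum_mulVec, dotProduct_sum, Complex.re_sum, Finset.sum_add_sum_compl]
  have hS' : (star ψ ⬝ᵥ (stagSpinStructure A *ᵥ ψ)).re =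
      2 * (star ψ ⬝ᵥ ((∑ x ∈ A, ∑ y ∈ A, fermionSpinDot x y) *ᵥ ψ)).re +
        2 * (star ψ ⬝ᵥ ((∑ x ∈ Aᶜ, ∑ y ∈ Aᶜ, fermionSpinDot x y) *ᵥ ψ)).re := by
    rw [stagSpinStructure_eq, sub_mulVec, add_mulVec, Matrix.smul_mulVec, Matrix.smul_mulVec,
      dotProduct_sub, dotProduct_add, dotProduct_smul, dotProduct_smul, htot, sub_zero, Complex.add_re,
      smul_eq_mul, smul_eq_mul, show (2 : ℂ) = ((2 : ℝ) : ℂ) by norm_num, Complex.re_ofReal_mul,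
      Complex.re_ofReal_mul]
  rw [hM, hS']
  linarith

/-- `IsGroundState` form of the Néel-sum floor (`expect X ψ = ⟨ψ, X ψ⟩`).
[cite: ShenQiuTian1994, Theorem and eqs. (7)–(9)] [cite: LiebPRL1989, Theorem 2] -/
theorem three_halves_localMoment_le_stagSpinStructure_of_isGroundState (hG : G.Connected) (A : Finset Λ)
    (hA : ∀ x y : Λ, G.Adj x y → (x ∈ A ↔ y ∉ A)) (hcard : Aᶜ.card = A.card)
    {t U : ℝ} (ht : t ≠ 0) (hU : 0 < U) {ψ : Fock (Orb Λ)}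
    (hψ : IsGroundState (hamiltonian G t U) (Fintype.card Λ) ψ) :
    (3 / 2 : ℝ) * (expect (∑ x, localMoment x) ψ).re ≤ (expect (stagSpinStructure A) ψ).re :=
  three_halves_localMoment_le_stagSpinStructure hG A hA hcard ht hU hψ.1 hψ.2.2

/-! ### §4b The AF sign structure and the domination of every modulated structure by the Néel sum -/

/-- **`ε_x ε_y ⟨ψ, 𝐒_x·𝐒_y ψ⟩` is a non-negative real** for THE half-filled ground state (isotropy ∘
sign rule, complex-order form). [cite: ShenQiuTian1994, Theorem and eqs. (7)–(9)] [cite: Tian2004, §3] -/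
theorem stagSign_mul_expect_fermionSpinDot_nonneg (hG : G.Connected) (A : Finset Λ)
    (hA : ∀ x y : Λ, G.Adj x y → (x ∈ A ↔ y ∉ A)) (hcard : Aᶜ.card = A.card)
    {t U : ℝ} (ht : t ≠ 0) (hU : 0 < U) {ψ : Fock (Orb Λ)} (hN : IsNParticle (Fintype.card Λ) ψ)
    (hHψ : hamiltonian G t U *ᵥ ψ = ((groundEnergyAt G t U (Fintype.card Λ) : ℝ) : ℂ) • ψ) (x y : Λ) :
    0 ≤ stagSign A x * stagSign A y * (star ψ ⬝ᵥ (fermionSpinDot x y *ᵥ ψ)) := by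
  have hmem : ψ ∈ (hamiltonian G t U).sectorGroundSpace
      (nParticleSubmodule (ι := Orb Λ) (Fintype.card Λ)) :=
    (LiebHalfFilled.mem_groundSector_iff G t U _ ψ).2 ⟨hN, hHψ⟩
  have hS := (LiebHalfFilled.finrank_groundSector_eq_one hG A hA hcard ht hU).2 ψ hmem
  obtain ⟨hP, hM, -⟩ := spin_mulVec_eq_zero_of_spinSq_mulVec_eq_zero hS
  have hsign := shenQiuTian_sign_rule hG A hA hcard ht hU hN hHψ x y
  rw [expect_fermionSpinDot_eq_of_singlet hP hM, mul_left_comm]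
  have h32 : (0 : ℂ) ≤ 3 / 2 := by
    rw [show (3 / 2 : ℂ) = ((3 / 2 : ℝ) : ℂ) by push_cast; ring]
    exact Complex.zero_le_real.2 (by norm_num)
  exact mul_nonneg h32 hsign

/-- **Opposite-sublattice spin correlations of THE half-filled ground state are non-positive** (the
antiferromagnetic sign of, e.g., every nearest-neighbour correlation): for `ε_x ε_y = -1`,
`Re ⟨ψ, 𝐒_x·𝐒_y ψ⟩ ≤ 0`. [cite: ShenQiuTian1994, Theorem and eqs. (7)–(9)] [cite: Tian2004, §3] -/
theorem re_expect_fermionSpinDot_nonpos_of_opposite_sublattice (hG : G.Connected) (A : Finset Λ)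
    (hA : ∀ x y : Λ, G.Adj x y → (x ∈ A ↔ y ∉ A)) (hcard : Aᶜ.card = A.card)
    {t U : ℝ} (ht : t ≠ 0) (hU : 0 < U) {ψ : Fock (Orb Λ)} (hN : IsNParticle (Fintype.card Λ) ψ)
    (hHψ : hamiltonian G t U *ᵥ ψ = ((groundEnergyAt G t U (Fintype.card Λ) : ℝ) : ℂ) • ψ)
    {x y : Λ} (hxy : stagSign A x * stagSign A y = -1) :
    (star ψ ⬝ᵥ (fermionSpinDot x y *ᵥ ψ)).re ≤ 0 := by
  have h := stagSign_mul_expect_fermionSpinDot_nonneg hG A hA hcard ht hU hN hHψ x y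
  rw [hxy, neg_one_mul] at h
  have h' := (Complex.nonneg_iff.mp h).1
  rw [Complex.neg_re] at h'
  linarith

/-- `x ∈ A`, `y ∈ Aᶜ` ⇒ `Re ⟨ψ, 𝐒_x·𝐒_y ψ⟩ ≤ 0`. [cite: ShenQiuTian1994, Theorem and eqs. (7)–(9)] -/
theorem re_expect_fermionSpinDot_nonpos_of_mem_of_mem_compl (hG : G.Connected) (A : Finset Λ)
    (hA : ∀ x y : Λ, G.Adj x y → (x ∈ A ↔ y ∉ A)) (hcard : Aᶜ.card = A.card)
    {t U : ℝ} (ht : t ≠ 0) (hU : 0 < U) {ψ : Fock (Orb Λ)} (hN : IsNParticle (Fintype.card Λ) ψ)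
    (hHψ : hamiltonian G t U *ᵥ ψ = ((groundEnergyAt G t U (Fintype.card Λ) : ℝ) : ℂ) • ψ)
    {x y : Λ} (hx : x ∈ A) (hy : y ∈ Aᶜ) :
    (star ψ ⬝ᵥ (fermionSpinDot x y *ᵥ ψ)).re ≤ 0 :=
  re_expect_fermionSpinDot_nonpos_of_opposite_sublattice hG A hA hcard ht hU hN hHψ
    (by rw [stagSign_of_mem hx, stagSign_of_mem_compl hy, one_mul])

/-- **Nearest-neighbour (indeed every bond's) spin correlation of THE half-filled ground state is
antiferromagnetic**: `x ∼ y ⇒ Re ⟨ψ, 𝐒_x·𝐒_y ψ⟩ ≤ 0`. [cite: ShenQiuTian1994, Theorem and eqs. (7)–(9)] -/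
theorem re_expect_fermionSpinDot_nonpos_of_adj (hG : G.Connected) (A : Finset Λ)
    (hA : ∀ x y : Λ, G.Adj x y → (x ∈ A ↔ y ∉ A)) (hcard : Aᶜ.card = A.card)
    {t U : ℝ} (ht : t ≠ 0) (hU : 0 < U) {ψ : Fock (Orb Λ)} (hN : IsNParticle (Fintype.card Λ) ψ)
    (hHψ : hamiltonian G t U *ᵥ ψ = ((groundEnergyAt G t U (Fintype.card Λ) : ℝ) : ℂ) • ψ)
    {x y : Λ} (hxy : G.Adj x y) :
    (star ψ ⬝ᵥ (fermionSpinDot x y *ᵥ ψ)).re ≤ 0 := by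
  refine re_expect_fermionSpinDot_nonpos_of_opposite_sublattice hG A hA hcard ht hU hN hHψ ?_
  by_cases hx : x ∈ A
  · have hy : y ∈ Aᶜ := Finset.mem_compl.2 ((hA x y hxy).1 hx)
    rw [stagSign_of_mem hx, stagSign_of_mem_compl hy, one_mul]
  · have hy : y ∈ A := (hA y x hxy.symm).mpr hx
    rw [stagSign_of_mem_compl (Finset.mem_compl.2 hx), stagSign_of_mem hy]; norm_num

omit [Fintype Λ] [DecidableRel G.Adj] in
/-- `‖ε_x‖ = 1`. [cite: LiebPRL1989, Theorem 2] -/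
theorem norm_stagSign (A : Finset Λ) (x : Λ) : ‖stagSign A x‖ = 1 := by
  unfold stagSign; split_ifs <;> simp

omit [LinearOrder Λ] [Fintype Λ] [DecidableRel G.Adj] in
/-- A non-negative complex number is its own real part in norm. [folklore] -/
private theorem norm_eq_re_of_nonneg {z : ℂ} (hz : 0 ≤ z) : ‖z‖ = z.re := by
  obtain ⟨hre, him⟩ := Complex.nonneg_iff.mp hz
  have h : z = ((z.re : ℝ) : ℂ) := Complex.ext rfl (by rw [Complex.ofReal_im]; exact him.symm)
  calc ‖z‖ = ‖((z.re : ℝ) : ℂ)‖ := congrArg _ h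
    _ = z.re := by rw [Complex.norm_real, Real.norm_of_nonneg hre]

/-- **`|⟨ψ, 𝐒_x·𝐒_y ψ⟩| = ε_x ε_y ⟨ψ, 𝐒_x·𝐒_y ψ⟩`** (as a bound: `‖·‖ ≤ Re (ε_x ε_y ·)`) for THE
half-filled ground state. [cite: ShenQiuTian1994, Theorem and eqs. (7)–(9)] -/
theorem norm_expect_fermionSpinDot_le (hG : G.Connected) (A : Finset Λ)
    (hA : ∀ x y : Λ, G.Adj x y → (x ∈ A ↔ y ∉ A)) (hcard : Aᶜ.card = A.card)
    {t U : ℝ} (ht : t ≠ 0) (hU : 0 < U) {ψ : Fock (Orb Λ)} (hN : IsNParticle (Fintype.card Λ) ψ)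
    (hHψ : hamiltonian G t U *ᵥ ψ = ((groundEnergyAt G t U (Fintype.card Λ) : ℝ) : ℂ) • ψ) (x y : Λ) :
    ‖star ψ ⬝ᵥ (fermionSpinDot x y *ᵥ ψ)‖ ≤
      (stagSign A x * stagSign A y * (star ψ ⬝ᵥ (fermionSpinDot x y *ᵥ ψ))).re := by
  have h := stagSign_mul_expect_fermionSpinDot_nonneg hG A hA hcard ht hU hN hHψ x y
  have hnorm : ‖stagSign A x * stagSign A y * (star ψ ⬝ᵥ (fermionSpinDot x y *ᵥ ψ))‖ =
      ‖star ψ ⬝ᵥ (fermionSpinDot x y *ᵥ ψ)‖ := by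
    rw [norm_mul, norm_mul, norm_stagSign, norm_stagSign, one_mul, one_mul]
  rw [← hnorm, norm_eq_re_of_nonneg h]

/-- **The Néel sum dominates every modulated spin structure.** For THE half-filled ground state and
all weights with `‖a_x‖ ≤ 1`, `‖b_y‖ ≤ 1`:
`|⟨ψ, (Σ_{x,y} a_x b_y 𝐒_x·𝐒_y) ψ⟩| ≤ Re ⟨ψ, 𝓢_A ψ⟩`; with `a_x = e^{iq·x}`, `b_y = e^{-iq·y}` this is
`S(q) ≤ S(Q)`: the spin structure factor of the half-filled ground state is maximal at the
antiferromagnetic wave vector. [cite: ShenQiuTian1994, Theorem and eqs. (7)–(9)] [cite: Tian2004, §3] -/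
theorem norm_expect_modulated_spinDot_le_stagSpinStructure (hG : G.Connected) (A : Finset Λ)
    (hA : ∀ x y : Λ, G.Adj x y → (x ∈ A ↔ y ∉ A)) (hcard : Aᶜ.card = A.card)
    {t U : ℝ} (ht : t ≠ 0) (hU : 0 < U) {ψ : Fock (Orb Λ)} (hN : IsNParticle (Fintype.card Λ) ψ)
    (hHψ : hamiltonian G t U *ᵥ ψ = ((groundEnergyAt G t U (Fintype.card Λ) : ℝ) : ℂ) • ψ)
    (a b : Λ → ℂ) (ha : ∀ x, ‖a x‖ ≤ 1) (hb : ∀ y, ‖b y‖ ≤ 1) :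
    ‖star ψ ⬝ᵥ ((∑ x, ∑ y, (a x * b y) • fermionSpinDot x y) *ᵥ ψ)‖ ≤
      (star ψ ⬝ᵥ (stagSpinStructure A *ᵥ ψ)).re := by
  set Gc : Λ → Λ → ℂ := fun x y => star ψ ⬝ᵥ (fermionSpinDot x y *ᵥ ψ) with hGc
  have hL : star ψ ⬝ᵥ ((∑ x, ∑ y, (a x * b y) • fermionSpinDot x y) *ᵥ ψ) =
      ∑ x, ∑ y, a x * b y * Gc x y := by
    simp only [hGc, Matrix.sum_mulVec, dotProduct_sum, Matrix.smul_mulVec, dotProduct_smul, smul_eq_mul]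
  have hR : (star ψ ⬝ᵥ (stagSpinStructure A *ᵥ ψ)).re =
      ∑ x, ∑ y, (stagSign A x * stagSign A y * Gc x y).re := by
    simp only [hGc, stagSpinStructure, Matrix.sum_mulVec, dotProduct_sum, Matrix.smul_mulVec,
      dotProduct_smul, smul_eq_mul, Complex.re_sum]
  rw [hL, hR]
  refine (norm_sum_le _ _).trans (Finset.sum_le_sum fun x _ => ?_)
  refine (norm_sum_le _ _).trans (Finset.sum_le_sum fun y _ => ?_)
  have hG := norm_expect_fermionSpinDot_le hG A hA hcard ht hU hN hHψ x y
  have hab : ‖a x * b y‖ ≤ 1 := by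
    rw [norm_mul]
    exact mul_le_one₀ (ha x) (norm_nonneg _) (hb y)
  calc ‖a x * b y * Gc x y‖ = ‖a x * b y‖ * ‖Gc x y‖ := norm_mul _ _
    _ ≤ 1 * ‖Gc x y‖ := by gcongr
    _ ≤ (stagSign A x * stagSign A y * Gc x y).re := by rw [one_mul]; exact hG

end Generic

/-! ### §5 The even square torus at half filling -/

section Torus

variable {L : ℕ} [NeZero L]

omit [NeZero L] in
/-- `|(ℤ/Lℤ)²| = L²` for the fermion torus. [folklore] -/
private theorem card_fermionTorus_sq : Fintype.card (FermionTorus 2 L) = L ^ 2 := by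
  simp only [FermionTorus, Fintype.card_lex, Fintype.card_fun, Fintype.card_fin]

/-- **The Shen–Qiu–Tian sign rule on the even square torus**: for every half-filled ground state of
`hamiltonian (fermionTorusGraph 2 L) t U` (`L` even, `t ≠ 0`, `U > 0`) and all sites `x, y`,
`ε_x ε_y Re ⟨ψ, S⁺_x S⁻_y ψ⟩ ≥ 0` with `ε = stagSign {x : (-1)^{x₁+x₂} = 1}`.
[cite: ShenQiuTian1994, Theorem and eqs. (7)–(9)] [cite: Tian2004, §3] -/
theorem hubbardTorus_shenQiuTian_sign_rule (hL : Even L) {t U : ℝ} (ht : t ≠ 0) (hU : 0 < U)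
    {ψ : Fock (Orb (FermionTorus 2 L))} (hN : IsNParticle (L ^ 2) ψ)
    (hHψ : hamiltonian (fermionTorusGraph 2 L) t U *ᵥ ψ =
      ((groundEnergyAt (fermionTorusGraph 2 L) t U (L ^ 2) : ℝ) : ℂ) • ψ) (x y : FermionTorus 2 L) :
    0 ≤ (stagSign (univ.filter fun z : FermionTorus 2 L => torusStagger z = 1) x *
        stagSign (univ.filter fun z : FermionTorus 2 L => torusStagger z = 1) y *
          (star ψ ⬝ᵥ ((fermionSpinPlus x * fermionSpinMinus y) *ᵥ ψ))).re := by
  obtain ⟨hG, hA, h2, -⟩ := LiebHalfFilled.hubbardTorus_lieb_hypotheses (L := L) hL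
  have hcard := LiebHalfFilled.compl_card_eq_card_of_two_mul h2
  rw [← card_fermionTorus_sq] at hN hHψ
  exact shenQiuTian_sign_rule_re hG _ hA hcard ht hU hN hHψ x y

/-- **The Néel-sum floor on the even square torus**: for every half-filled ground state of
`hamiltonian (fermionTorusGraph 2 L) t U` (`L` even, `t ≠ 0`, `U > 0`),
`(3/2) Re ⟨ψ, (Σ_x m_x) ψ⟩ ≤ Re ⟨ψ, 𝓢_A ψ⟩` with `A = {x : (-1)^{x₁+x₂} = 1}`; i.e. the finite-volume
staggered magnetisation obeys `m_s² = ⟨𝓢_A⟩/L⁴ ≥ (3/2) m_loc / L²`, `m_loc = ⟨Σ_x m_x⟩/L² = 1 - 2d`.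
[cite: ShenQiuTian1994, Theorem and eqs. (7)–(9)] [cite: LiebPRL1989, Theorem 2] -/
theorem hubbardTorus_three_halves_localMoment_le_stagSpinStructure (hL : Even L) {t U : ℝ}
    (ht : t ≠ 0) (hU : 0 < U) {ψ : Fock (Orb (FermionTorus 2 L))} (hN : IsNParticle (L ^ 2) ψ)
    (hHψ : hamiltonian (fermionTorusGraph 2 L) t U *ᵥ ψ =
      ((groundEnergyAt (fermionTorusGraph 2 L) t U (L ^ 2) : ℝ) : ℂ) • ψ) :
    (3 / 2 : ℝ) * (star ψ ⬝ᵥ ((∑ x, localMoment x) *ᵥ ψ)).re ≤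
      (star ψ ⬝ᵥ (stagSpinStructure (univ.filter fun z : FermionTorus 2 L => torusStagger z = 1) *ᵥ ψ)).re := by
  obtain ⟨hG, hA, h2, -⟩ := LiebHalfFilled.hubbardTorus_lieb_hypotheses (L := L) hL
  have hcard := LiebHalfFilled.compl_card_eq_card_of_two_mul h2
  rw [← card_fermionTorus_sq] at hN hHψ
  exact three_halves_localMoment_le_stagSpinStructure hG _ hA hcard ht hU hN hHψ

/-- `IsGroundState` form of the torus Néel-sum floor.
[cite: ShenQiuTian1994, Theorem and eqs. (7)–(9)] [cite: LiebPRL1989, Theorem 2] -/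
theorem hubbardTorus_three_halves_localMoment_le_stagSpinStructure_of_isGroundState (hL : Even L)
    {t U : ℝ} (ht : t ≠ 0) (hU : 0 < U) {ψ : Fock (Orb (FermionTorus 2 L))}
    (hψ : IsGroundState (hamiltonian (fermionTorusGraph 2 L) t U) (L ^ 2) ψ) :
    (3 / 2 : ℝ) * (expect (∑ x, localMoment x) ψ).re ≤
      (expect (stagSpinStructure (univ.filter fun z : FermionTorus 2 L => torusStagger z = 1)) ψ).re :=
  hubbardTorus_three_halves_localMoment_le_stagSpinStructure hL ht hU hψ.1 hψ.2.2

/-- **AF bond correlations on the even square torus**: for every half-filled ground state of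
`hamiltonian (fermionTorusGraph 2 L) t U` (`L` even, `t ≠ 0`, `U > 0`) and every bond `x ∼ y`,
`Re ⟨ψ, 𝐒_x·𝐒_y ψ⟩ ≤ 0`. [cite: ShenQiuTian1994, Theorem and eqs. (7)–(9)] -/
theorem hubbardTorus_re_expect_fermionSpinDot_nonpos_of_adj (hL : Even L) {t U : ℝ} (ht : t ≠ 0)
    (hU : 0 < U) {ψ : Fock (Orb (FermionTorus 2 L))} (hN : IsNParticle (L ^ 2) ψ)
    (hHψ : hamiltonian (fermionTorusGraph 2 L) t U *ᵥ ψ =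
      ((groundEnergyAt (fermionTorusGraph 2 L) t U (L ^ 2) : ℝ) : ℂ) • ψ) {x y : FermionTorus 2 L}
    (hxy : (fermionTorusGraph 2 L).Adj x y) :
    (star ψ ⬝ᵥ (fermionSpinDot x y *ᵥ ψ)).re ≤ 0 := by
  obtain ⟨hG, hA, h2, -⟩ := LiebHalfFilled.hubbardTorus_lieb_hypotheses (L := L) hL
  have hcard := LiebHalfFilled.compl_card_eq_card_of_two_mul h2
  rw [← card_fermionTorus_sq] at hN hHψ
  exact re_expect_fermionSpinDot_nonpos_of_adj hG _ hA hcard ht hU hN hHψ hxy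

/-- **Néel-sum domination on the even square torus**: for every half-filled ground state and all
weights `‖a_x‖, ‖b_y‖ ≤ 1`, `|⟨ψ, (Σ_{x,y} a_x b_y 𝐒_x·𝐒_y) ψ⟩| ≤ Re ⟨ψ, 𝓢_A ψ⟩`
(`A = {x : (-1)^{x₁+x₂} = 1}`); in particular `S(q) ≤ S(π,π)` for every momentum `q`.
[cite: ShenQiuTian1994, Theorem and eqs. (7)–(9)] [cite: Tian2004, §3] -/
theorem hubbardTorus_norm_expect_modulated_spinDot_le_stagSpinStructure (hL : Even L) {t U : ℝ}
    (ht : t ≠ 0) (hU : 0 < U) {ψ : Fock (Orb (FermionTorus 2 L))} (hN : IsNParticle (L ^ 2) ψ)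
    (hHψ : hamiltonian (fermionTorusGraph 2 L) t U *ᵥ ψ =
      ((groundEnergyAt (fermionTorusGraph 2 L) t U (L ^ 2) : ℝ) : ℂ) • ψ)
    (a b : FermionTorus 2 L → ℂ) (ha : ∀ x, ‖a x‖ ≤ 1) (hb : ∀ y, ‖b y‖ ≤ 1) :
    ‖star ψ ⬝ᵥ ((∑ x, ∑ y, (a x * b y) • fermionSpinDot x y) *ᵥ ψ)‖ ≤
      (star ψ ⬝ᵥ (stagSpinStructure (univ.filter fun z : FermionTorus 2 L => torusStagger z = 1) *ᵥ ψ)).re := by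
  obtain ⟨hG, hA, h2, -⟩ := LiebHalfFilled.hubbardTorus_lieb_hypotheses (L := L) hL
  have hcard := LiebHalfFilled.compl_card_eq_card_of_two_mul h2
  rw [← card_fermionTorus_sq] at hN hHψ
  exact norm_expect_modulated_spinDot_le_stagSpinStructure hG _ hA hcard ht hU hN hHψ a b ha hb

end Torus

end Literature.MathematicalPhysics.QuantumLattice
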